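import Summits.BirchSwinnertonDyer.BirchSwinnertonDyer.Theorems.KolyvaginDepthDoorDepthTablePointCert
import Summits.BirchSwinnertonDyer.BirchSwinnertonDyer.Theorems.KolyvaginDepthDoorDepthTableRowKitNoTwistTwistSelmer
import HarnessLib

/-!
# Route `KolyvaginDepthDoor` — the twist-free DEPTH-TABLE ROW KIT in POINT-CERTIFICATE form: the
# Jetchev–Lauter–Stein test `P(ℓ) ∉ p·E(K[ℓ])` as input (crux `KolyvaginDepthSupply`,
# stmt-BirchSwinnertonDyer-21765)

Helper file (`--supports stmt-BirchSwinnertonDyer-21765 --as helper`); it closes nothing and BSD is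
not proved by it.

The twist-free row kits `depthRow_noTwist_of_print_of_intModel_certificate` (file
`…DepthTableRowKitNoTwist`) and `depthRow_noTwist_twistSelmer_of_print_of_intModel_certificate` (file
`…DepthTableRowKitNoTwistTwistSelmer`) take the row's BIT as `(d ℓ).kolyvaginClass hp 1 ≠ 0`. What a
compute seat actually certifies (Jetchev–Lauter–Stein, arXiv:0707.0032 §3.2/§3.6) is the point statement
"`P(ℓ) = Σ_{σ ∈ S} σ(D_ℓ y(ℓ))` is not `p`-divisible in `E(K[ℓ])`", the tree's `¬ Koly.PDiv (d ℓ) p 1`; g4's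
`kolyvaginClass_ne_zero_of_intModel_certificate_of_tower` (file `…DepthTablePointCert`: McCallum Cor. 4.5,
Gross Lemma 4.3 / Prop. 3.6) converts it into the bit on integer-model certificates, for the tower
`m ↦ d m` (`m ∣ ℓ`) cut out of the system. This file composes:

* `depthRow_noTwist_of_print_of_notPDiv` — inputs of the twist-free kit with `hne` replaced by
  `¬ Koly.PDiv (d ℓ) p 1` (plus `D < −4`, the standing hypothesis of the point-certificate lemma);
  output `t_p(E) = 0`, `rank E(ℚ) = 2`, `rank E^{(D)}(ℚ) ≤ 1`, `E(ℚ)[p] = 0`, `Ш(E/ℚ)[p] = 0`,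
  `#Sel^(p)(E/ℚ) = p²`;
* `twistSelmer_noTwist_of_print_of_notPDiv` — same inputs; output `#Sel^(p)(E^{(D)}/ℚ) ≤ p` and
  `p^{rank E^{(D)}} · #E^{(D)}(ℚ)[p] · #Ш(E^{(D)}/ℚ)[p] ≤ p`.

So the per-row deliverable of a compute seat is literally: a frame `(Dt, β, ι)`, a compatible system of
Kolyvagin–Heegner data on it, and the verified statement "no `Q ∈ E(K[ℓ])` with `p·Q = P(ℓ)`" — NO point on
the twist, NO Kolyvagin Thm. 4. CONDITIONAL on the five named McCallum/Gross leaves; per-curve; BSD is not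
proved by it.

References: [JetchevLauterStein2009] arXiv:0707.0032 §3.2, §3.6; [McCallumLMS1991] §4 Cor. 4.5, §5;
[GrossLMS1991] Prop. 3.6, Lemma 4.3, §5 (5.1); [Kolyvagin1991MathAnn] Thm. 2.3; [WZhang2014] Notations (xii).
-/

set_option linter.dupNamespace false

noncomputable section

open scoped Classical NumberField

namespace Summit.BirchSwinnertonDyer.BirchSwinnertonDyer.Theorems.KolyvaginDepthDoor

open Literature.NumberTheory.EllipticCurves Literature.NumberTheory.EllipticCurves.ModularForms
  Literature.NumberTheory.EllipticCurves.McCallum1991 WeierstrassCurve NumberField IsDedekindDomain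
open Summit.BirchSwinnertonDyer.Rank1Residual.X11b.Three

section Generic

variable {W : WeierstrassCurve ℚ} [W.IsElliptic] [W.IsGloballyMinimal] {E₀ : WeierstrassCurve ℤ}
  (hI : integralModelInt W = E₀)
include hI

/-- **The twist-free depth-table row from a POINT CERTIFICATE.** Inputs of
`depthRow_noTwist_of_print_of_intModel_certificate` (integer model, `2 ≤ rank`, `p` odd with its
surjectivity tower, Heegner field `K` with `d_K = D ∉ {−3, −4}`, Kolyvagin prime `ℓ`, compatible system
`d` of Kolyvagin–Heegner data, the five named McCallum facts) with the bit REPLACED by the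
Jetchev–Lauter–Stein point statement `¬ Koly.PDiv (d ℓ) p 1` ("`P(ℓ) ∉ p·E(K[ℓ])`") and `D < −4`.
Output: `corank_{ℤ_p} Ш(E/ℚ)[p^∞] = 0`, `rank_ℤ E(ℚ) = 2`, `rank_ℤ E^{(D)}(ℚ) ≤ 1`, `E(ℚ)[p] = 0`,
`Ш(E/ℚ)[p] = 0`, `#Sel^(p)(E/ℚ) = p²`. CONDITIONAL on the five facts; per-curve; BSD is not proved by it.
[cite: JetchevLauterStein2009, §3.2 and §3.6 (arXiv:0707.0032)] [cite: McCallumLMS1991, §4 Cor. 4.5]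
[cite: Kolyvagin1991MathAnn, Thm. 2.3] [cite: GrossLMS1991, §5 (5.1)] -/
theorem depthRow_noTwist_of_print_of_notPDiv
    (h54 : sign_conjAct_kolyvaginClass) (h43 : lemma43_kolyvaginClass_mem_selmerLocalKer)
    (h44 : prop44_localOrder_kolyvaginClass_mul_eq) (h53 : lemma53_selmer_eigen_dependent_at)
    (h22 : prop22_reciprocity_eigen_finset)
    (hcm : ¬ W.HasCM) (hr : 2 ≤ W.mordellWeilRank)
    (p : ℕ) [hp : Fact p.Prime] (hp2 : p ≠ 2)
    (htower : ∀ n : ℕ, W.HasSurjectiveModNGaloisRep (p ^ n : ℕ))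
    (K : Type) [Field K] [NumberField K] (hK : IsImaginaryQuadratic K) {D : ℤ}
    (hD : NumberField.discr K = D) (h3 : D ≠ -3) (h4 : D ≠ -4)
    (hH : ∀ q : ℕ, q.Prime → (q : ℤ) ∣ E₀.Δ → (q = 2 → D % 8 = 1) ∧ (q ≠ 2 → jacobiSym D q = 1))
    (ℓ : ℕ) (hℓ : ℓ.Prime) (hℓ2 : ℓ ≠ 2) (hℓΔ : ¬ (ℓ : ℤ) ∣ E₀.Δ) (hℓD : ¬ (ℓ : ℤ) ∣ D)
    (hℓp : ℓ ≠ p) (hjac : jacobiSym D ℓ = -1) (hℓ1 : p ∣ ℓ + 1) {n : ℕ}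
    (hcard : Nat.card ((E₀.map (Int.castRingHom (ZMod ℓ))).toAffine.Point) = n)
    (haℓ : (p : ℤ) ∣ (ℓ : ℤ) + 1 - n)
    [NeZero (W.conductorNorm ℤ)] (Dt : ModularParametrizationData W (W.conductorNorm ℤ)) (β : ℤ)
    (ι : K →+* ℂ) (d : ∀ m : ℕ, KolyvaginHeegnerData Dt β ι m)
    (hσ : ∀ (m l : ℕ), ∀ l' ∈ m.primeFactors, ∀ (x : ringClassField K ι m)
      (x' : ringClassField K ι (m * l)),
      (x : ℂ) = x' → (((d (m * l)).σ l' x' : ringClassField K ι (m * l)) : ℂ) = ((d m).σ l' x : ℂ))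
    (hS₁ : ∀ (m l : ℕ), ∀ s ∈ (d m).S, ∃ s' ∈ (d (m * l)).S, ∀ (x : ringClassField K ι m)
      (x' : ringClassField K ι (m * l)),
      (x : ℂ) = x' → ((s' x' : ringClassField K ι (m * l)) : ℂ) = (s x : ℂ))
    (hS₂ : ∀ (m l : ℕ), ∀ s' ∈ (d (m * l)).S, ∃ s ∈ (d m).S, ∀ (x : ringClassField K ι m)
      (x' : ringClassField K ι (m * l)),
      (x : ℂ) = x' → ((s' x' : ringClassField K ι (m * l)) : ℂ) = (s x : ℂ))
    (hemb : ∀ (m l : ℕ) (x : ringClassField K ι m) (x' : ringClassField K ι (m * l)),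
      (x : ℂ) = x' → (d (m * l)).emb x' = (d m).emb x)
    (hD4 : D < -4) (hcert : ¬ Koly.PDiv (d ℓ) p 1) :
    W.shaCorank p = 0 ∧ W.mordellWeilRank = 2 ∧ (W.quadraticTwist (D : ℚ)).mordellWeilRank ≤ 1 ∧
      (∀ P : W.toAffine.Point, p • P = 0 → P = 0) ∧ (∀ c ∈ W.sha, p • c = 0 → c = 0) ∧
      Nat.card ↥(selmerGroup W (p : ℤ)) = p ^ 2 := by
  have hsurj : W.HasSurjectiveModNGaloisRep p := by simpa only [pow_one] using htower 1
  exact depthRow_noTwist_of_print_of_intModel_certificate hI h54 h43 h44 h53 h22 hcm hr p hp2 htower K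
    hK hD h3 h4 hH ℓ hℓ hℓ2 hℓΔ hℓD hℓp hjac hℓ1 hcard haℓ Dt β ι d hσ hS₁ hS₂ hemb
    (kolyvaginClass_ne_zero_of_intModel_certificate_of_tower hI p hp2 hsurj K hK hD hD4 hH ℓ hℓ hℓ2
      hℓΔ hℓD hℓp hjac hℓ1 hcard haℓ Dt β ι (fun m _ ↦ d m) hcert)

/-- **The twist's `p`-Selmer group from a POINT CERTIFICATE, no twist point.** Same inputs; output
`#Sel^(p)(E^{(D)}/ℚ) ≤ p` and `p^{rank_ℤ E^{(D)}(ℚ)} · #E^{(D)}(ℚ)[p] · #Ш(E^{(D)}/ℚ)[p] ≤ p`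
(`depthRow_noTwist_twistSelmer_of_print_of_intModel_certificate` with the point-certificate lemma).
CONDITIONAL on the five facts; per-curve; BSD is not proved by it.
[cite: JetchevLauterStein2009, §3.2 and §3.6 (arXiv:0707.0032)] [cite: McCallumLMS1991, §4 Cor. 4.5]
[cite: Kolyvagin1991MathAnn, Thm. 2.3] [cite: GrossLMS1991, §5 (5.1)] -/
theorem twistSelmer_noTwist_of_print_of_notPDiv
    (h54 : sign_conjAct_kolyvaginClass) (h43 : lemma43_kolyvaginClass_mem_selmerLocalKer)
    (h44 : prop44_localOrder_kolyvaginClass_mul_eq) (h53 : lemma53_selmer_eigen_dependent_at)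
    (h22 : prop22_reciprocity_eigen_finset)
    (hcm : ¬ W.HasCM) (hr : 2 ≤ W.mordellWeilRank)
    (p : ℕ) [hp : Fact p.Prime] (hp2 : p ≠ 2)
    (htower : ∀ n : ℕ, W.HasSurjectiveModNGaloisRep (p ^ n : ℕ))
    (K : Type) [Field K] [NumberField K] (hK : IsImaginaryQuadratic K) {D : ℤ}
    (hD : NumberField.discr K = D) (h3 : D ≠ -3) (h4 : D ≠ -4)
    (hH : ∀ q : ℕ, q.Prime → (q : ℤ) ∣ E₀.Δ → (q = 2 → D % 8 = 1) ∧ (q ≠ 2 → jacobiSym D q = 1))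
    (ℓ : ℕ) (hℓ : ℓ.Prime) (hℓ2 : ℓ ≠ 2) (hℓΔ : ¬ (ℓ : ℤ) ∣ E₀.Δ) (hℓD : ¬ (ℓ : ℤ) ∣ D)
    (hℓp : ℓ ≠ p) (hjac : jacobiSym D ℓ = -1) (hℓ1 : p ∣ ℓ + 1) {n : ℕ}
    (hcard : Nat.card ((E₀.map (Int.castRingHom (ZMod ℓ))).toAffine.Point) = n)
    (haℓ : (p : ℤ) ∣ (ℓ : ℤ) + 1 - n)
    [NeZero (W.conductorNorm ℤ)] (Dt : ModularParametrizationData W (W.conductorNorm ℤ)) (β : ℤ)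
    (ι : K →+* ℂ) (d : ∀ m : ℕ, KolyvaginHeegnerData Dt β ι m)
    (hσ : ∀ (m l : ℕ), ∀ l' ∈ m.primeFactors, ∀ (x : ringClassField K ι m)
      (x' : ringClassField K ι (m * l)),
      (x : ℂ) = x' → (((d (m * l)).σ l' x' : ringClassField K ι (m * l)) : ℂ) = ((d m).σ l' x : ℂ))
    (hS₁ : ∀ (m l : ℕ), ∀ s ∈ (d m).S, ∃ s' ∈ (d (m * l)).S, ∀ (x : ringClassField K ι m)
      (x' : ringClassField K ι (m * l)),
      (x : ℂ) = x' → ((s' x' : ringClassField K ι (m * l)) : ℂ) = (s x : ℂ))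
    (hS₂ : ∀ (m l : ℕ), ∀ s' ∈ (d (m * l)).S, ∃ s ∈ (d m).S, ∀ (x : ringClassField K ι m)
      (x' : ringClassField K ι (m * l)),
      (x : ℂ) = x' → ((s' x' : ringClassField K ι (m * l)) : ℂ) = (s x : ℂ))
    (hemb : ∀ (m l : ℕ) (x : ringClassField K ι m) (x' : ringClassField K ι (m * l)),
      (x : ℂ) = x' → (d (m * l)).emb x' = (d m).emb x)
    (hD4 : D < -4) (hcert : ¬ Koly.PDiv (d ℓ) p 1) :
    Nat.card ↥(selmerGroup (W.quadraticTwist (D : ℚ)) (p : ℤ)) ≤ p ∧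
      p ^ (W.quadraticTwist (D : ℚ)).mordellWeilRank *
          Nat.card ↥(AddSubgroup.torsionBy (W.quadraticTwist (D : ℚ)).toAffine.Point (p : ℤ)) *
          Nat.card ↥((W.quadraticTwist (D : ℚ)).sha ⊓
            AddSubgroup.torsionBy (W.quadraticTwist (D : ℚ)).galH1 (p : ℤ)) ≤ p := by
  have hsurj : W.HasSurjectiveModNGaloisRep p := by simpa only [pow_one] using htower 1
  exact depthRow_noTwist_twistSelmer_of_print_of_intModel_certificate hI h54 h43 h44 h53 h22 hcm hr p
    hp2 htower K hK hD h3 h4 hH ℓ hℓ hℓ2 hℓΔ hℓD hℓp hjac hℓ1 hcard haℓ Dt β ι d hσ hS₁ hS₂ hemb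
    (kolyvaginClass_ne_zero_of_intModel_certificate_of_tower hI p hp2 hsurj K hK hD hD4 hH ℓ hℓ hℓ2
      hℓΔ hℓD hℓp hjac hℓ1 hcard haℓ Dt β ι (fun m _ ↦ d m) hcert)

end Generic

end Summit.BirchSwinnertonDyer.BirchSwinnertonDyer.Theorems.KolyvaginDepthDoor

end
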